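import Literature.NumberTheory.LFunctions.LocalRiemannHypothesis
import Mathlib.Analysis.Complex.Polynomial.Basic
import HarnessLib

/-!
# The local Riemann hypothesis for Laguerre–Mellin polynomials (Gilbert 1991, `α > -1`)

Gilbert [cite: Gilbert1991, Prop 2, Thm 5] (generalising Bump–Ng's Hermite case, and = the
`n`-dimensional-oscillator / general-`α` statement [cite: BumpEtAl2000, Thm 4]): the Mellin
transforms of `e^{-x/2} L_n^α(x)`, normalised so that the imaginary axis is the axis of symmetry,
are polynomials `p_n(s, α)` with `p_0 = 1`, `p_1 = s` and
`p_{n+1}(s, α) = s·p_n(s, α) + (n(α+n)/4)·p_{n−1}(s, α)` (Prop. 2); for `α > −1` all their zeros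
are purely imaginary and simple (Thm 5, the positive-definite case).

This is the same Jacobi-recursion argument as the Hermite case: `p_n(iE, α) = i^n·P_n(E)` where
`P_n` is `jacobiPoly` with the weights `β_k = k(α+k)/4`, positive for `k ≥ 1` iff `α > −1`
(`aeval_laguerreMellinPoly`), so `LocalRH.jacobiPoly_im_eq_zero_of_aeval_eq_zero` and
`…_derivative_aeval_ne_zero` give Theorem 5 (`laguerreMellinPoly_re_eq_zero`,
`laguerreMellinPoly_derivative_ne_zero`; counting form `roots_map_laguerreMellinPoly`: `n` distinct
zeros, all on the axis). In the census of finite Hilbert–Pólya constructions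
these are the `α`-ladder cells of Gilbert's model (all `K` levels on the axis for `α > −1`).

Not here: the quasi-definite side `α < −1` of Theorem 5 (real zeros occur; Gilbert's Thm 4), the
boundary case `α = −1`, and the Mellin-integral identification of `p_n(s, α)` (Gilbert eq. (5)–(6)).
-/

namespace Literature.NumberTheory.LFunctions

open Polynomial Complex

namespace LocalRH

/-- Gilbert's weights `β_k(α) = k(α+k)/4`. [cite: Gilbert1991, Prop 2] -/
noncomputable def laguerreWeight (α : ℝ) (k : ℕ) : ℝ := k * (α + k) / 4

/-- `β_{k+1}(α) = (k+1)(α+k+1)/4 > 0` when `α > −1`. [cite: Gilbert1991, Thm 5] -/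
theorem laguerreWeight_succ_pos {α : ℝ} (hα : -1 < α) (k : ℕ) : 0 < laguerreWeight α (k + 1) := by
  unfold laguerreWeight
  have hk : (0 : ℝ) ≤ k := Nat.cast_nonneg k
  push_cast
  have : 0 < α + (k + 1) := by linarith
  positivity

/-- The Laguerre–Mellin polynomials `p_n(s, α)` of Gilbert (variable `s`, symmetry axis `Re s = 0`):
`p_0 = 1`, `p_1 = s`, `p_{n+2} = s·p_{n+1} + ((n+1)(α+n+1)/4)·p_n`. [cite: Gilbert1991, Prop 2] -/
noncomputable def laguerreMellinPoly (α : ℝ) : ℕ → ℝ[X]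
  | 0 => 1
  | 1 => X
  | (n + 2) => X * laguerreMellinPoly α (n + 1) + C (laguerreWeight α (n + 1)) * laguerreMellinPoly α n

/-- `p_0 = 1`. [cite: Gilbert1991, Prop 2] -/
@[simp] theorem laguerreMellinPoly_zero (α : ℝ) : laguerreMellinPoly α 0 = 1 := rfl
/-- `p_1 = s`. [cite: Gilbert1991, Prop 2] -/
@[simp] theorem laguerreMellinPoly_one (α : ℝ) : laguerreMellinPoly α 1 = X := rfl

/-- The recursion `p_{n+2} = s·p_{n+1} + β_{n+1}(α)·p_n`. [cite: Gilbert1991, Prop 2] -/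
theorem laguerreMellinPoly_add_two (α : ℝ) (n : ℕ) :
    laguerreMellinPoly α (n + 2) =
      X * laguerreMellinPoly α (n + 1) + C (laguerreWeight α (n + 1)) * laguerreMellinPoly α n := rfl

/-- Evaluated recursion over `ℂ`. [cite: Gilbert1991, Prop 2] -/
theorem aeval_laguerreMellinPoly_add_two (α : ℝ) (n : ℕ) (s : ℂ) :
    aeval s (laguerreMellinPoly α (n + 2)) = s * aeval s (laguerreMellinPoly α (n + 1)) +
      (laguerreWeight α (n + 1) : ℂ) * aeval s (laguerreMellinPoly α n) := by
  rw [laguerreMellinPoly_add_two, map_add, map_mul, map_mul, aeval_X, aeval_C]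
  rfl

/-- **Rotation to the Jacobi recursion** (Gilbert's Prop. 1 device `p̃_n(z) = (−i)^n p_n(iz)`):
`p_n(iE, α) = i^n · P_n(E)` with `P_n = jacobiPoly (laguerreWeight α) n`.
[cite: Gilbert1991, Prop 1 and Prop 2] -/
theorem aeval_laguerreMellinPoly (α : ℝ) (E : ℂ) : ∀ n,
    aeval (I * E) (laguerreMellinPoly α n) = I ^ n * aeval E (jacobiPoly (laguerreWeight α) n)
  | 0 => by simp
  | 1 => by simp
  | (n + 2) => by
    rw [aeval_laguerreMellinPoly_add_two, aeval_jacobiPoly_add_two, aeval_laguerreMellinPoly α E (n + 1),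
      aeval_laguerreMellinPoly α E n]
    linear_combination ((laguerreWeight α (n + 1) : ℂ) * I ^ n *
      aeval E (jacobiPoly (laguerreWeight α) n)) * I_sq

/-- `I · (−I·s) = s`. [folklore] -/
private theorem I_mul_negI_mul (s : ℂ) : I * (-I * s) = s := by
  rw [← mul_assoc, mul_neg, I_mul_I, neg_neg, one_mul]

/-- **Gilbert's Theorem 5, positive-definite case** [cite: Gilbert1991, Thm 5]: for `α > −1` every
complex zero of the Laguerre–Mellin polynomial `p_n(·, α)` is purely imaginary (i.e. lies on the
symmetry axis `Re s = 0`, the normalised critical line) — the general-`α` local Riemann hypothesis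
[cite: BumpEtAl2000, Thm 4]. -/
theorem laguerreMellinPoly_re_eq_zero {α : ℝ} (hα : -1 < α) (n : ℕ) {s : ℂ}
    (hs : aeval s (laguerreMellinPoly α n) = 0) : s.re = 0 := by
  set E : ℂ := -I * s with hE
  have hsE : s = I * E := (I_mul_negI_mul s).symm
  rw [hsE, aeval_laguerreMellinPoly] at hs
  have hP : aeval E (jacobiPoly (laguerreWeight α) n) = 0 := by
    rcases mul_eq_zero.mp hs with h | h
    · exact absurd h (pow_ne_zero _ I_ne_zero)
    · exact h
  have him := jacobiPoly_im_eq_zero_of_aeval_eq_zero (laguerreWeight_succ_pos hα) hP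
  have : E.im = -s.re := by rw [hE]; simp [Complex.mul_im]
  linarith

/-- The zeros of `p_n(·, α)` are exactly `s = iE` with `E` a (real) zero of the Jacobi polynomial
`P_n` with weights `k(α+k)/4`. [cite: Gilbert1991, Prop 1 and Prop 2] -/
theorem aeval_laguerreMellinPoly_eq_zero_iff (α : ℝ) (n : ℕ) (s : ℂ) :
    aeval s (laguerreMellinPoly α n) = 0 ↔ aeval (-I * s) (jacobiPoly (laguerreWeight α) n) = 0 := by
  conv_lhs => rw [← I_mul_negI_mul s, aeval_laguerreMellinPoly]
  simp [I_ne_zero]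

/-- The polynomial identity `p_n(·,α) = i^n · P_n ∘ (−i·X)` in `ℂ[X]`. [cite: Gilbert1991, Prop 1] -/
theorem map_laguerreMellinPoly (α : ℝ) (n : ℕ) :
    (laguerreMellinPoly α n).map (algebraMap ℝ ℂ) =
      C (I ^ n) * ((jacobiPoly (laguerreWeight α) n).map (algebraMap ℝ ℂ)).comp (C (-I) * X) := by
  apply Polynomial.funext
  intro s
  have e2 : ∀ p : ℝ[X], (p.map (algebraMap ℝ ℂ)).eval (-I * s) = aeval (-I * s) p := fun p => by
    rw [eval_map, aeval_def]
  have e3 : (C (-I) * X : ℂ[X]).eval s = -I * s := by simp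
  rw [eval_map, ← aeval_def, eval_mul, eval_C, eval_comp, e3, e2,
    ← aeval_laguerreMellinPoly α (-I * s) n, I_mul_negI_mul]

/-- **Simplicity** [cite: Gilbert1991, Thm 5]: for `α > −1` the zeros of `p_n(·, α)` are simple. -/
theorem laguerreMellinPoly_derivative_ne_zero {α : ℝ} (hα : -1 < α) (n : ℕ) {s : ℂ}
    (hs : aeval s (laguerreMellinPoly α n) = 0) :
    aeval s (derivative (laguerreMellinPoly α n)) ≠ 0 := by
  rw [aeval_laguerreMellinPoly_eq_zero_iff] at hs
  have h := congrArg (fun p => (derivative p).eval s) (map_laguerreMellinPoly α n)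
  simp only [derivative_map, eval_map] at h
  rw [← aeval_def] at h
  have e2 : ∀ p : ℝ[X], (p.map (algebraMap ℝ ℂ)).eval (-I * s) = aeval (-I * s) p := fun p => by
    rw [eval_map, aeval_def]
  have e3 : (C (-I) * X : ℂ[X]).eval s = -I * s := by simp
  have e4 : (derivative (C (-I) * X : ℂ[X])).eval s = -I := by simp
  rw [h, derivative_C_mul, derivative_comp, eval_mul, eval_C, eval_mul, eval_comp, e3, e4,
    derivative_map, e2]
  refine mul_ne_zero (pow_ne_zero _ I_ne_zero) (mul_ne_zero (neg_ne_zero.mpr I_ne_zero) ?_)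
  exact jacobiPoly_derivative_aeval_ne_zero (laguerreWeight_succ_pos hα) hs

/-- **Symmetry** `p_n(−s, α) = (−1)^n p_n(s, α)` (the imaginary axis is the axis of symmetry).
[cite: Gilbert1991, §2, normalisation of p_n(s, α)] -/
theorem laguerreMellinPoly_neg (α : ℝ) (s : ℂ) : ∀ n,
    aeval (-s) (laguerreMellinPoly α n) = (-1) ^ n * aeval s (laguerreMellinPoly α n)
  | 0 => by simp
  | 1 => by simp
  | (n + 2) => by
    rw [aeval_laguerreMellinPoly_add_two, aeval_laguerreMellinPoly_add_two, laguerreMellinPoly_neg α s (n + 1),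
      laguerreMellinPoly_neg α s n, pow_succ, pow_succ]
    ring

/-- `p_n(·, α)` has degree `n`. [cite: Gilbert1991, §2, "symmetric of degree n"] -/
theorem natDegree_map_laguerreMellinPoly (α : ℝ) (n : ℕ) :
    ((laguerreMellinPoly α n).map (algebraMap ℝ ℂ)).natDegree = n := by
  rw [map_laguerreMellinPoly, natDegree_C_mul (pow_ne_zero _ I_ne_zero), natDegree_comp,
    natDegree_map_eq_of_injective (algebraMap ℝ ℂ).injective, jacobiPoly_natDegree,
    natDegree_C_mul (neg_ne_zero.mpr I_ne_zero), natDegree_X, mul_one]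

/-- Evaluation of the `ℂ`-image of `p_n(·, α)` is `aeval`. [folklore] -/
private theorem eval_map_laguerreMellinPoly (α : ℝ) (n : ℕ) (s : ℂ) :
    ((laguerreMellinPoly α n).map (algebraMap ℝ ℂ)).eval s = aeval s (laguerreMellinPoly α n) := by
  rw [eval_map, aeval_def]

/-- **Counting form of Gilbert's Theorem 5** (`α > −1`): the complex roots of `p_n(·, α)` form a
multiset of cardinality `n` without repetition, all on the imaginary axis — `n` distinct simple
purely imaginary zeros. [cite: Gilbert1991, Thm 5] -/
theorem roots_map_laguerreMellinPoly {α : ℝ} (hα : -1 < α) (n : ℕ) :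
    Multiset.card ((laguerreMellinPoly α n).map (algebraMap ℝ ℂ)).roots = n ∧
    ((laguerreMellinPoly α n).map (algebraMap ℝ ℂ)).roots.Nodup ∧
    ∀ s ∈ ((laguerreMellinPoly α n).map (algebraMap ℝ ℂ)).roots, s.re = 0 := by
  set P := (laguerreMellinPoly α n).map (algebraMap ℝ ℂ) with hP
  have hP0 : P ≠ 0 := by
    intro h
    have h1 : aeval (1 : ℂ) (laguerreMellinPoly α n) = 0 := by
      rw [← eval_map_laguerreMellinPoly, ← hP, h, eval_zero]
    have := laguerreMellinPoly_re_eq_zero hα n h1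
    norm_num at this
  refine ⟨?_, ?_, ?_⟩
  · rw [← (IsAlgClosed.splits P).natDegree_eq_card_roots, hP, natDegree_map_laguerreMellinPoly]
  · classical
    refine Multiset.nodup_iff_count_le_one.mpr fun s => ?_
    rw [count_roots]
    by_contra hlt
    push Not at hlt
    obtain ⟨h1, h2⟩ := (one_lt_rootMultiplicity_iff_isRoot hP0).mp hlt
    rw [IsRoot.def, hP, eval_map_laguerreMellinPoly] at h1
    rw [IsRoot.def, hP, derivative_map, eval_map, ← aeval_def] at h2
    exact laguerreMellinPoly_derivative_ne_zero hα n h1 h2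
  · intro s hs
    have h := (mem_roots hP0).mp hs
    rw [IsRoot.def, hP, eval_map_laguerreMellinPoly] at h
    exact laguerreMellinPoly_re_eq_zero hα n h

end LocalRH

end Literature.NumberTheory.LFunctions
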